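import Literature.RingTheory.CohomologyAnnihilator.AnnihilationOfCohomology
import Literature.RingTheory.CohomologyAnnihilator.Localization
import Literature.RingTheory.CohomologyAnnihilator.RegularLocalRing
import HarnessLib

/-!
# Iyengar–Takahashi, `V(ca R) = V(ca^{2d+1} R) = Sing R`: proofs

Topic: `Literature/RingTheory/CohomologyAnnihilator`. Proof file for the named facts of
`AnnihilationOfCohomology.lean` ([IyengarTakahashi2014], arXiv:1404.1476, IMRN 2016), following the
printed proofs.

## What is proved here

* `exists_smul_eq_zero_of_extLocalizationMap_eq_zero` — the INJECTIVITY half of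
  "`U⁻¹Extⁱ_R(M, N) ≅ Extⁱ_{U⁻¹R}(U⁻¹M, U⁻¹N)` for `M` finitely generated over a noetherian ring"
  (the surjectivity half is `span_range_extLocalizationMap_eq_top` of `Localization.lean`): an
  element of `Extⁱ_R(M, N)` that dies in `Extⁱ_{U⁻¹R}(U⁻¹M, U⁻¹N)` is killed by some `u ∈ U`.
  Proof by dimension shifting along a finite presentation `0 → K → P → M → 0`, exactly as for the
  surjectivity half. [cite: IyengarTakahashi2014, Lemma 2.10 (proof)]
* `cohomologyAnnihilator_le_of_not_isRegularLocalRing` — **Lemma 2.10 (2)**, `Sing R ⊆ V(ca R)`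
  for a commutative noetherian ring: Lemma 2.10 (1) (`Localization.lean`) plus
  "`ca(R_𝔭) = (1)` forces `gldim R_𝔭 < ∞`", i.e. `R_𝔭` regular (Auslander–Buchsbaum–Serre,
  `RegularLocalRing.lean`). Whence the discharges `singSubsetVCa_holds` and `caLocalization_holds`
  of the two auxiliary named facts of `AnnihilationOfCohomology.lean`.
* `annihilator_ext_not_le_of_isRegularLocalRing` — the last step of the proof of **Theorem 4.3**:
  for finitely generated `G`, `H` over a noetherian ring `A` of Krull dimension `≤ d` and a prime
  `𝔮` with `A_𝔮` regular, `ann_A Ext^{d+1}_A(G, H) ⊄ 𝔮`, because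
  `Ext^{d+1}_A(G, H)_𝔮 ↪ Ext^{d+1}_{A_𝔮}(G_𝔮, H_𝔮) = 0` (`gldim A_𝔮 = dim A_𝔮 ≤ d`) and the module
  is finitely generated.
* `singEqVCa_essFiniteType_of_exists_generator` — **Theorem 5.4** (`V(ca R) = V(ca^{2d+1} R) =
  Sing R` for localisations `R = U⁻¹A` of finitely generated algebras `A` of Krull dimension `d`
  over a field), DERIVED — as in the printed proof (Theorem 4.3 applied to the strong generator of
  Theorem 5.4) — from the existence, for every such `A`, of a finitely generated "test pair"
  `G, H` and `n` with `(ann_A Ext^{d+1}_A(G, H))ⁿ ⊆ ca^{2d+1}(A)`; in the paper `H = Ω^{d+1}G` for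
  the strong generator `G` (`Ω^d(mod A) ⊆ |G|ₙ`, Theorem 5.4) and the inclusion is Lemma 4.2. That
  existence statement — the strong-generation half of Theorem 5.4 (Noether different, separable
  Noether normalisation, Theorems 3.6/5.1/5.2, Lemma 4.8, base change to `k̄`) — is the only input
  not proved in this file; it is taken as an explicit hypothesis, stated in expanded form.

## References

* S. B. Iyengar, R. Takahashi, *Annihilation of cohomology and strong generation of module
  categories*, Int. Math. Res. Not. IMRN 2016, no. 2, 499–535; arXiv:1404.1476.
  [`IyengarTakahashi2014`]: Lemma 2.10, Lemma 4.2, Theorem 4.3, Theorem 5.4.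
-/

noncomputable section

open CategoryTheory CategoryTheory.Abelian IsLocalRing

universe u

namespace Literature.RingTheory.CohomologyAnnihilator

variable {R : Type u} [CommRing R] (U : Submonoid R)

/-! ## The comparison map `Extⁱ_R(M, N) → Extⁱ_{U⁻¹R}(U⁻¹M, U⁻¹N)` is a localisation: injectivity -/

variable {U} in
/-- The comparison map is additive. [folklore] -/
theorem extLocalizationMap_add {M N : ModuleCat.{u} R} {i : ℕ} (e e' : Ext.{u} M N i) :
    extLocalizationMap U M N i (e + e') =
      extLocalizationMap U M N i e + extLocalizationMap U M N i e' :=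
  map_add ((ModuleCat.localizedModuleFunctor.{u} U).mapExtAddHom M N i) e e'

variable {U} in
/-- The comparison map is additive. [folklore] -/
theorem extLocalizationMap_sub {M N : ModuleCat.{u} R} {i : ℕ} (e e' : Ext.{u} M N i) :
    extLocalizationMap U M N i (e - e') =
      extLocalizationMap U M N i e - extLocalizationMap U M N i e' :=
  map_sub ((ModuleCat.localizedModuleFunctor.{u} U).mapExtAddHom M N i) e e'

/-- Clearing denominators in `Extⁱ_{U⁻¹R}(U⁻¹M, U⁻¹N) = U⁻¹R · im(Extⁱ_R(M, N))` (the surjectivity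
half, `span_range_extLocalizationMap_eq_top`): every class downstairs is `(1/s) ·` (the image of a
class upstairs). [cite: IyengarTakahashi2014, Lemma 2.10 (proof)] -/
theorem exists_smul_eq_extLocalizationMap [IsNoetherianRing R] {M N : ModuleCat.{u} R}
    [Module.Finite R M] {i : ℕ} (x : Ext.{u} (M.localizedModule U) (N.localizedModule U) i) :
    ∃ (s : U) (y : Ext.{u} M N i),
      algebraMap R (Localization U) s • x = extLocalizationMap U M N i y := by
  have hx : x ∈ Submodule.span (Localization U) (Set.range (extLocalizationMap U M N i)) := by
    rw [span_range_extLocalizationMap_eq_top U i M N ‹_›]; trivial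
  induction hx using Submodule.span_induction with
  | mem x hx =>
    obtain ⟨y, rfl⟩ := hx
    exact ⟨1, y, by simp⟩
  | zero => exact ⟨1, 0, by rw [smul_zero, extLocalizationMap_zero]⟩
  | add x x' _ _ hx hx' =>
    obtain ⟨s, y, h⟩ := hx
    obtain ⟨s', y', h'⟩ := hx'
    refine ⟨s * s', (s' : R) • y + (s : R) • y', ?_⟩
    rw [extLocalizationMap_add, extLocalizationMap_smul, extLocalizationMap_smul, ← h, ← h',
      smul_add, Submonoid.coe_mul, map_mul, mul_smul, mul_smul, smul_comm]
  | smul c x _ hx =>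
    obtain ⟨s, y, h⟩ := hx
    obtain ⟨⟨r, t⟩, hc⟩ := IsLocalization.surj U c
    refine ⟨s * t, r • y, ?_⟩
    rw [extLocalizationMap_smul, ← h, Submonoid.coe_mul, map_mul, smul_smul, smul_smul,
      mul_assoc, mul_comm _ c, hc, mul_comm]

/-- **Injectivity half of `U⁻¹Extⁱ_R(M, N) ≅ Extⁱ_{U⁻¹R}(U⁻¹M, U⁻¹N)`** (`R` noetherian, `M`
finitely generated): a class `e ∈ Extⁱ_R(M, N)` whose image in `Extⁱ_{U⁻¹R}(U⁻¹M, U⁻¹N)` vanishes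
is killed by some `u ∈ U`. Dimension shifting: in degree `0` this is
`Hom_{U⁻¹R}(U⁻¹M, U⁻¹N) = U⁻¹Hom_R(M, N)` for finitely presented `M`; in degree `i + 1`, write
`e = δ e'` along a presentation `0 → K → P → M → 0` with `P` finite free; the image of `e'` dies
under `δ` downstairs, so it is the restriction of a class on `U⁻¹P`, which after clearing
denominators comes from `Extⁱ_R(P, N)`; subtract, apply the induction hypothesis to `K`, and use
`δ ∘ (restriction from P) = 0`. [cite: IyengarTakahashi2014, Lemma 2.10 (proof)] -/
theorem exists_smul_eq_zero_of_extLocalizationMap_eq_zero [IsNoetherianRing R] (i : ℕ) :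
    ∀ (M N : ModuleCat.{u} R), Module.Finite R M → ∀ e : Ext.{u} M N i,
      extLocalizationMap U M N i e = 0 → ∃ u : U, (u : R) • e = 0 := by
  induction i with
  | zero =>
    intro M N hM e he
    obtain ⟨g, rfl⟩ := (Ext.mk₀_bijective _ _).2 e
    rw [extLocalizationMap_mk₀] at he
    have hg : ModuleCat.localizedModuleMap U g = 0 :=
      (Ext.mk₀_bijective _ _).1 (by rw [he, Ext.mk₀_zero])
    have : Module.FinitePresentation R M := Module.finitePresentation_of_finite R M
    have hg' : IsLocalizedModule.mapExtendScalars U (M.localizedModuleMkLinearMap U)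
        (N.localizedModuleMkLinearMap U) (Localization U) g.hom = 0 := by
      change (ModuleCat.localizedModuleMap U g).hom = 0
      rw [hg]
      rfl
    obtain ⟨u, hu⟩ := (IsLocalizedModule.eq_zero_iff U
      (IsLocalizedModule.mapExtendScalars U (M.localizedModuleMkLinearMap U)
        (N.localizedModuleMkLinearMap U) (Localization U))).mp hg'
    refine ⟨u, ?_⟩
    have hug : (u : R) • g = 0 := by
      apply ModuleCat.hom_ext
      rw [ModuleCat.hom_smul, ModuleCat.hom_zero, ← Submonoid.smul_def, hu]
    rw [← Ext.mk₀_smul (C := ModuleCat.{u} R), hug, Ext.mk₀_zero]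
  | succ i ih =>
    intro M N hM e he
    obtain ⟨P, _, _, _, _, f, surjf⟩ := Module.exists_finite_presentation R M
    have hS := LinearMap.shortExact_shortComplexKer surjf
    haveI : Module.Finite R (LinearMap.ker f) := Module.IsNoetherian.finite R _
    have hFS := hS.map_of_exact (ModuleCat.localizedModuleFunctor.{u} U)
    have proj := ModuleCat.projective_of_categoryTheory_projective f.shortComplexKer.X₂
    obtain ⟨e', rfl⟩ := precomp_extClass_surjective_of_projective_X₂ N hS i e
    -- the image of `e'` dies under the connecting map downstairs
    have h1 : hFS.extClass.comp
        (extLocalizationMap U (ModuleCat.of R (LinearMap.ker f)) N i e') (add_comm 1 i) = 0 := by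
      rw [← extLocalizationMap_extClass_comp hS N e']
      exact he
    obtain ⟨x₂, hx₂⟩ :
        ∃ x₂ : Ext.{u} ((ModuleCat.of R P).localizedModule U) (N.localizedModule U) i,
          (Ext.mk₀ (ModuleCat.localizedModuleMap U f.shortComplexKer.f)).comp x₂ (zero_add i) =
            extLocalizationMap U (ModuleCat.of R (LinearMap.ker f)) N i e' :=
      Ext.contravariant_sequence_exact₁ hFS _ _ (add_comm 1 i) h1
    -- clear denominators: `s • x₂` comes from `Extⁱ_R(P, N)`
    haveI : Module.Finite R (ModuleCat.of R P) := ‹Module.Finite R P›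
    obtain ⟨s, y, hsy⟩ := exists_smul_eq_extLocalizationMap U (M := ModuleCat.of R P) x₂
    have h2 : extLocalizationMap U (ModuleCat.of R (LinearMap.ker f)) N i
        ((s : R) • e' - (Ext.mk₀ f.shortComplexKer.f).comp y (zero_add i)) = 0 := by
      rw [extLocalizationMap_sub, extLocalizationMap_smul, extLocalizationMap_comp,
        extLocalizationMap_mk₀, ← hsy, Ext.comp_smul, hx₂, sub_self]
    obtain ⟨t, ht⟩ := ih (ModuleCat.of R (LinearMap.ker f)) N inferInstance _ h2
    refine ⟨t * s, ?_⟩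
    rw [smul_sub, sub_eq_zero, ← mul_smul, ← Ext.comp_smul] at ht
    change ((t : R) * s) • hS.extClass.comp e' (add_comm 1 i) = 0
    rw [← Ext.comp_smul, ht, hS.extClass_comp_assoc]

/-! ## Lemma 2.10 (2): `Sing R ⊆ V(ca R)` -/

/-- **Lemma 2.10 (2)** for a commutative noetherian ring `R`: if `R_𝔭` is not a regular local ring
then `ca(R) ⊆ 𝔭`. Printed proof: for `𝔭 ⊉ ca(R)`, Lemma 2.10 (1) gives `ca(R_𝔭) = (1)`, hence
`gldim R_𝔭 < ∞`, i.e. `R_𝔭` is regular (Auslander–Buchsbaum–Serre); we run it contrapositively: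
`x ∈ ca(R)` maps into `ca(R_𝔭) ⊆ 𝔪_{R_𝔭}` (`RegularLocalRing.lean`), so `x ∈ 𝔭`.
[cite: IyengarTakahashi2014, Lemma 2.10 (2)] -/
theorem cohomologyAnnihilator_le_of_not_isRegularLocalRing [IsNoetherianRing R] (𝔭 : Ideal R)
    [𝔭.IsPrime] (h : ¬ IsRegularLocalRing (Localization.AtPrime 𝔭)) :
    cohomologyAnnihilator R ≤ 𝔭 := by
  intro x hx
  have hx' := algebraMap_mem_cohomologyAnnihilator_of_isLocalization 𝔭.primeCompl
    (Localization.AtPrime 𝔭) hx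
  have hle := cohomologyAnnihilator_le_maximalIdeal_of_not_isRegularLocalRing
    (Localization.AtPrime 𝔭) h
  exact (IsLocalization.AtPrime.to_map_mem_maximal_iff (Localization.AtPrime 𝔭) 𝔭 x).mp (hle hx')

/-- **Lemma 2.10 (2)**, degreewise: if `R_𝔭` is not regular then `caⁿ(R) ⊆ 𝔭` for every `n`
(as `caⁿ(R) ⊆ ca(R)`). [cite: IyengarTakahashi2014, Lemma 2.10 (2)] -/
theorem cohomologyAnnihilatorOfDegree_le_of_not_isRegularLocalRing [IsNoetherianRing R]
    (𝔭 : Ideal R) [𝔭.IsPrime] (h : ¬ IsRegularLocalRing (Localization.AtPrime 𝔭)) (n : ℕ) :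
    cohomologyAnnihilatorOfDegree R n ≤ 𝔭 :=
  (cohomologyAnnihilatorOfDegree_le n).trans (cohomologyAnnihilator_le_of_not_isRegularLocalRing 𝔭 h)

/-- **Lemma 2.10 (2)** over the vocabulary `ca` of `AnnihilationOfCohomology.lean`: if `R_𝔭` is not
regular then `ca R ⊆ 𝔭` (`R` noetherian). [cite: IyengarTakahashi2014, Lemma 2.10 (2)] -/
theorem ca_le_of_not_isRegularLocalRing [IsNoetherianRing R] (𝔭 : Ideal R) [𝔭.IsPrime]
    (h : ¬ IsRegularLocalRing (Localization.AtPrime 𝔭)) : ca R ≤ 𝔭 := by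
  rw [ca_eq_cohomologyAnnihilator]
  exact cohomologyAnnihilator_le_of_not_isRegularLocalRing 𝔭 h

/-- **Lemma 2.10 (2)** over the vocabulary `caFrom` of `AnnihilationOfCohomology.lean`: if `R_𝔭` is
not regular then `caⁿ(R) ⊆ 𝔭` (`R` noetherian). [cite: IyengarTakahashi2014, Lemma 2.10 (2)] -/
theorem caFrom_le_of_not_isRegularLocalRing [IsNoetherianRing R] (𝔭 : Ideal R) [𝔭.IsPrime]
    (h : ¬ IsRegularLocalRing (Localization.AtPrime 𝔭)) (n : ℕ) : caFrom R n ≤ 𝔭 :=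
  (caFrom_le_ca R n).trans (ca_le_of_not_isRegularLocalRing 𝔭 h)

/-- DISCHARGE of the named fact `singSubsetVCa` (**Lemma 2.10 (2)**: `Sing R ⊆ V(ca R)` for every
commutative noetherian ring). [cite: IyengarTakahashi2014, Lemma 2.10 (2)] -/
theorem singSubsetVCa_holds : singSubsetVCa.{u} := by
  intro R _ hR 𝔭 _ h
  exact ca_le_of_not_isRegularLocalRing 𝔭 h

/-- DISCHARGE of the named fact `caLocalization` (**Lemma 2.10 (1)**: `U⁻¹caⁿ(R) ⊆ caⁿ(U⁻¹R)` and
`U⁻¹ca(R) ⊆ ca(U⁻¹R)`), by the proofs of `Localization.lean` transported along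
`caFrom = cohomologyAnnihilatorOfDegree`, `ca = cohomologyAnnihilator`.
[cite: IyengarTakahashi2014, Lemma 2.10 (1)] -/
theorem caLocalization_holds : caLocalization.{u} := by
  intro R _ hR U R' _ _ hR'
  refine ⟨fun n => ?_, ?_⟩
  · rw [caFrom_eq_cohomologyAnnihilatorOfDegree, caFrom_eq_cohomologyAnnihilatorOfDegree]
    exact map_cohomologyAnnihilatorOfDegree_le_of_isLocalization U R' n
  · rw [ca_eq_cohomologyAnnihilator, ca_eq_cohomologyAnnihilator]
    exact map_cohomologyAnnihilator_le_of_isLocalization U R'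

/-! ## Theorem 4.3, last step: `ann_A Ext^{d+1}_A(G, H) ⊄ 𝔮` at regular primes `𝔮` -/

section TestModule

variable {A : Type u} [CommRing A]

/-- `gldim A_𝔮 ≤ d` at a regular prime of height `≤ d`: for a prime `𝔮` with `A_𝔮` regular and
`ht 𝔮 ≤ d`, `Extⁱ_{A_𝔮}(M', N') = 0` for all finitely generated `A_𝔮`-modules and `i ≥ d + 1`
(Serre: every finite module over the regular local ring `A_𝔮` has projective dimension
`≤ dim A_𝔮 = ht 𝔮`; `RegularLocalRing.lean`). [cite: IyengarTakahashi2014, Theorem 4.3 (proof)] -/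
theorem ext_eq_zero_of_isRegularLocalRing_localization (𝔮 : Ideal A) [𝔮.IsPrime]
    [IsRegularLocalRing (Localization.AtPrime 𝔮)] {d : ℕ} (hd : 𝔮.height ≤ d) {i : ℕ}
    (hi : d + 1 ≤ i) (M' N' : ModuleCat.{u} (Localization.AtPrime 𝔮))
    [Module.Finite (Localization.AtPrime 𝔮) M'] [Module.Finite (Localization.AtPrime 𝔮) N']
    (e : Ext.{u} M' N' i) : e = 0 := by
  obtain ⟨d', hd'⟩ : ∃ d' : ℕ, 𝔮.height = d' :=
    ENat.ne_top_iff_exists.mp (ne_top_of_le_ne_top (ENat.coe_ne_top d) hd) |>.imp fun _ h => h.symm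
  have hdim : ringKrullDim (Localization.AtPrime 𝔮) = d' := by
    rw [IsLocalization.AtPrime.ringKrullDim_eq_height 𝔮, hd']
    rfl
  have hd'd : d' ≤ d := by
    rw [hd'] at hd
    exact_mod_cast hd
  have htop := cohomologyAnnihilatorOfDegree_eq_top_of_isRegularLocalRing
    (Localization.AtPrime 𝔮) hdim
  exact cohomologyAnnihilatorOfDegree_eq_top_iff.mp htop i (by omega) M' N' ‹_› ‹_› e

/-- **Theorem 4.3, last step** ("`Ext^{d+1}_Λ(G, Ω^{d+1}G)_𝔭 ≅ Ext^{d+1}_{Λ_𝔭}(G_𝔭, (Ω^{d+1}G)_𝔭)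
≅ 0` … for any finitely generated module `E` one has `E_𝔭 = 0` iff `ann E ⊄ 𝔭`"): over a
noetherian ring `A`, for finitely generated `G`, `H`, a prime `𝔮` with `A_𝔮` regular and
`ht 𝔮 ≤ d`, and `i ≥ d + 1`, the annihilator of the (finitely generated) `A`-module `Extⁱ_A(G, H)`
is not contained in `𝔮`: every class dies in `Extⁱ_{A_𝔮}(G_𝔮, H_𝔮) = 0`, hence (injectivity half
of the localisation of `Ext`) is killed by an element outside `𝔮`.
[cite: IyengarTakahashi2014, Theorem 4.3 (proof)] -/
theorem annihilator_ext_not_le_of_isRegularLocalRing [IsNoetherianRing A] (G H : ModuleCat.{u} A)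
    [Module.Finite A G] [Module.Finite A H] (𝔮 : Ideal A) [𝔮.IsPrime]
    (hreg : IsRegularLocalRing (Localization.AtPrime 𝔮)) {d : ℕ} (hd : 𝔮.height ≤ d) {i : ℕ}
    (hi : d + 1 ≤ i) : ¬ Module.annihilator A (Ext.{u} G H i) ≤ 𝔮 := by
  have key : ∀ e : Ext.{u} G H i, ∃ u ∉ 𝔮, u • e = 0 := by
    intro e
    haveI : Module.Finite (Localization.AtPrime 𝔮) (G.localizedModule 𝔮.primeCompl) :=
      Module.Finite.of_isLocalizedModule 𝔮.primeCompl (G.localizedModuleMkLinearMap 𝔮.primeCompl)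
    haveI : Module.Finite (Localization.AtPrime 𝔮) (H.localizedModule 𝔮.primeCompl) :=
      Module.Finite.of_isLocalizedModule 𝔮.primeCompl (H.localizedModuleMkLinearMap 𝔮.primeCompl)
    have h0 : extLocalizationMap 𝔮.primeCompl G H i e = 0 :=
      ext_eq_zero_of_isRegularLocalRing_localization 𝔮 hd hi _ _ _
    obtain ⟨u, hu⟩ := exists_smul_eq_zero_of_extLocalizationMap_eq_zero 𝔮.primeCompl i G H ‹_› e h0
    exact ⟨u, u.2, hu⟩
  intro hle
  have hmem : (⟨𝔮, ‹_›⟩ : PrimeSpectrum A) ∈ Module.support A (Ext.{u} G H i) :=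
    Module.mem_support_iff_of_finite.mpr hle
  exact Module.notMem_support_iff'.mpr key hmem

/-- From a "test pair" to the singular locus (**Theorem 4.3**, `V(I) ⊆ Sing` combined with
`Iⁿ ⊆ ca^{2d+1}`): if `A` is noetherian of Krull dimension `d` and finitely generated `G`, `H` and
`n` satisfy `(ann_A Ext^{d+1}_A(G, H))ⁿ ⊆ ca^{2d+1}(A)`, then `ca^{2d+1}(A) ⊄ 𝔮` for every prime
`𝔮` with `A_𝔮` regular. [cite: IyengarTakahashi2014, Theorem 4.3 (proof)] -/
theorem cohomologyAnnihilatorOfDegree_not_le_of_isRegularLocalRing [IsNoetherianRing A] {d : ℕ}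
    (hdim : ringKrullDim A = d) {G H : ModuleCat.{u} A} [Module.Finite A G] [Module.Finite A H]
    {n : ℕ} (hGH : (Module.annihilator A (Ext.{u} G H (d + 1))) ^ n ≤
      cohomologyAnnihilatorOfDegree A (2 * d + 1))
    (𝔮 : Ideal A) [𝔮.IsPrime] (hreg : IsRegularLocalRing (Localization.AtPrime 𝔮)) :
    ¬ cohomologyAnnihilatorOfDegree A (2 * d + 1) ≤ 𝔮 := by
  intro hle
  have hht : 𝔮.height ≤ d := by
    have h := Ideal.height_le_ringKrullDim_of_isPrime (I := 𝔮)
    rw [hdim] at h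
    exact_mod_cast h
  have hI := annihilator_ext_not_le_of_isRegularLocalRing G H 𝔮 hreg hht (le_refl (d + 1))
  rcases Nat.eq_zero_or_pos n with hn | hn
  · subst hn
    rw [pow_zero, Ideal.one_eq_top, top_le_iff] at hGH
    exact (Ideal.IsPrime.ne_top ‹_›) (top_le_iff.mp (hGH ▸ hle))
  · exact hI ((Ideal.IsPrime.pow_le_iff (Nat.pos_iff_ne_zero.mp hn)).mp (hGH.trans hle))

end TestModule

/-! ## Theorem 5.4: reduction to the finitely generated algebra and assembly -/

section Assembly

variable {A : Type u} [CommRing A]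

/-- **Theorem 5.4, reduction `R = U⁻¹A ⇝ A`** for the inclusion `V(caᵐ R) ⊆ Sing R`: if `caᵐ(A) ⊄ 𝔮`
for every prime `𝔮` of the noetherian ring `A` with `A_𝔮` regular, then `caᵐ(R) ⊄ 𝔭` for every
prime `𝔭` of a localisation `R = U⁻¹A` with `R_𝔭` regular: with `𝔮 = 𝔭 ∩ A` one has
`A_𝔮 ≅ R_𝔭`, and `caᵐ(A)R ⊆ caᵐ(R)` (Lemma 2.10 (1)). [cite: IyengarTakahashi2014, Theorem 5.4 (proof)] -/
theorem cohomologyAnnihilatorOfDegree_not_le_of_isLocalization [IsNoetherianRing A] {m : ℕ}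
    (hA : ∀ (𝔮 : Ideal A) [𝔮.IsPrime], IsRegularLocalRing (Localization.AtPrime 𝔮) →
      ¬ cohomologyAnnihilatorOfDegree A m ≤ 𝔮)
    (U : Submonoid A) (R' : Type u) [CommRing R'] [Algebra A R'] [IsLocalization U R']
    (𝔭 : Ideal R') [𝔭.IsPrime] (hreg : IsRegularLocalRing (Localization.AtPrime 𝔭)) :
    ¬ cohomologyAnnihilatorOfDegree R' m ≤ 𝔭 := by
  intro hle
  -- `A_𝔮 ≅ R_𝔭` for `𝔮 = 𝔭 ∩ A`
  haveI : (𝔭.comap (algebraMap A R')).IsPrime := Ideal.comap_isPrime _ 𝔭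
  haveI : IsLocalization.AtPrime (Localization.AtPrime 𝔭) (𝔭.comap (algebraMap A R')) :=
    IsLocalization.isLocalization_isLocalization_atPrime_isLocalization U
      (Localization.AtPrime 𝔭) 𝔭
  let e : Localization.AtPrime (𝔭.comap (algebraMap A R')) ≃ₐ[A] Localization.AtPrime 𝔭 :=
    IsLocalization.algEquiv (𝔭.comap (algebraMap A R')).primeCompl _ _
  have hreg' : IsRegularLocalRing (Localization.AtPrime (𝔭.comap (algebraMap A R'))) :=
    IsRegularLocalRing.of_ringEquiv e.symm.toRingEquiv
  apply hA (𝔭.comap (algebraMap A R')) hreg'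
  intro a ha
  rw [Ideal.mem_comap]
  exact hle (map_cohomologyAnnihilatorOfDegree_le_of_isLocalization U R' m
    (Ideal.mem_map_of_mem _ ha))

/-- **Theorem 5.4** ([IyengarTakahashi2014]: `V(ca R) = V(ca^{2d+1} R) = Sing R` for a localisation
`R` of a finitely generated algebra `A` of Krull dimension `d` over a field `k`), in the rendering
`singEqVCa_essFiniteType` of `AnnihilationOfCohomology.lean`, DERIVED — following the printed
proof: Theorem 4.3 applied to the strong generator — from its strong-generation input in the
processed form "for every finitely generated `A` of Krull dimension `d` over a field there are
finitely generated `A`-modules `G`, `H` and `n` with `(ann_A Ext^{d+1}_A(G, H))ⁿ ⊆ ca^{2d+1}(A)`"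
(in the paper: `G` with `Ω^d(mod A) ⊆ |G|ₙ` by Theorem 5.4, `H = Ω^{d+1}G`, and the inclusion is
Lemma 4.2 via Remark 2.2). Given that input: `Sing ⊆ V(ca) ⊆ V(ca^{2d+1})` is Lemma 2.10 (2), and
`V(ca^{2d+1}) ⊆ Sing` is `cohomologyAnnihilatorOfDegree_not_le_of_isRegularLocalRing` for `A`
transported to `R = U⁻¹A` by `cohomologyAnnihilatorOfDegree_not_le_of_isLocalization`.
[cite: IyengarTakahashi2014, Theorem 5.4] -/
theorem singEqVCa_essFiniteType_of_exists_generator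
    (hgen : ∀ (k : Type u) [Field k] (A : Type u) [CommRing A] [Algebra k A],
      Algebra.FiniteType k A → ∀ d : ℕ, ringKrullDim A = d →
        ∃ (G H : ModuleCat.{u} A), Module.Finite A G ∧ Module.Finite A H ∧ ∃ n : ℕ,
          (Module.annihilator A (Ext.{u} G H (d + 1))) ^ n ≤
            cohomologyAnnihilatorOfDegree A (2 * d + 1)) :
    singEqVCa_essFiniteType.{u} := by
  intro k _ A _ _ hA d hd U R _ _ hR 𝔭 _
  haveI : IsNoetherianRing A := Algebra.FiniteType.isNoetherianRing k A
  haveI : IsNoetherianRing R := IsLocalization.isNoetherianRing U R inferInstance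
  obtain ⟨G, H, hG, hH, n, hGH⟩ := hgen k A hA d hd
  have hb : IsRegularLocalRing (Localization.AtPrime 𝔭) → ¬ caFrom R (2 * d + 1) ≤ 𝔭 := by
    intro hreg
    rw [caFrom_eq_cohomologyAnnihilatorOfDegree]
    exact cohomologyAnnihilatorOfDegree_not_le_of_isLocalization
      (fun 𝔮 _ h𝔮 => cohomologyAnnihilatorOfDegree_not_le_of_isRegularLocalRing hd hGH 𝔮 h𝔮)
      U R 𝔭 hreg
  refine ⟨⟨fun hca hreg => hb hreg ((caFrom_le_ca R _).trans hca),
    fun h => ca_le_of_not_isRegularLocalRing 𝔭 h⟩,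
    ⟨fun hca hreg => hb hreg hca, fun h => caFrom_le_of_not_isRegularLocalRing 𝔭 h _⟩⟩

end Assembly

end Literature.RingTheory.CohomologyAnnihilator
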